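import Literature.MathematicalPhysics.QuantumFieldTheory.MullerSchiemann1987.MS87Theorem3Climb
import Literature.MathematicalPhysics.QuantumFieldTheory.MullerSchiemann1987.MS87Theorem3InitialData
import Literature.MathematicalPhysics.QuantumFieldTheory.MullerSchiemann1987.MS87PositiveTypeIterates
import Literature.MathematicalPhysics.QuantumFieldTheory.MullerSchiemann1987.MS87WilsonPositiveType
import Literature.MathematicalPhysics.QuantumFieldTheory.MullerSchiemann1987.MS87HeatKernelPositiveType
import Literature.MathematicalPhysics.QuantumLattice.HeatKernelGroupOperatorProofs
import Literature.Analysis.Matrix.PosDefKernelDoubleIntegral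
import Literature.Analysis.OperatorTheory.CompactPositiveRootUnique
import HarnessLib

/-!
# Müller–Schiemann, *Continuum limit of a hierarchical SU(2) lattice gauge theory in 4 dimensions*
# (CMP 110, 1987), p.283 L.23–27: PROPERTY (ii) OF THE MIGDAL TRANSFORMATION — «𝒯 is injective on
# 𝔉₀ := {g ∈ 𝔉, g is of positive type}» — PROVED (any compact Hausdorff group, every `r ≥ 1`), and THEOREM 3's
# printed climb (`MS87Theorem3Climb`) made unconditional (theorems only; no definition, no named fact)

statement-level skeleton of published theorems with citation tags; proofs where landed; nothing here is a claim about the Yang–Mills mass gap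

**Citation header (reproduction of PUBLISHED work).** V. F. Müller, J. Schiemann, *Continuum limit of a hierarchical
SU(2) lattice gauge theory in 4 dimensions*, Commun. Math. Phys. **110** (1987) 261–286, doi 10.1007/BF01207367
[MullerSchiemann1987]; Theorem 3 p.282 and its proof p.282 L.29 – p.283 L.37, in particular p.283 L.23–27 (held
Project Euclid scan `paper:url-96df5da18d4c`, PDF page = journal page − 260; read by this seat on its own 3× page
render `run/shared/lean/pub/lit-balaban/lit-balaban-p12/renders-cmp110ms/ms87-cmp110-pdfp023-journalp283-x3.png`).
Lean lane of the lit-balaban YM LIT SWEEP CONTEXT row X1 (register level; zero weight for any token of that table);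
the model is the `d = 4` HIERARCHICAL `SU(2)` gauge model (Migdal's recursion as an exact renormalization group), NOT
lattice Yang–Mills.

**What the paper prints (p.283 L.23–27).** *«The final steps of our proof rely on two general properties of the
Migdal transformation 𝒯, namely (i) 𝒯 is continuous (with respect to the supremum norm) on
𝔉 := {g(u) continuous class function on G, g(u) ≥ 0, g(e₀) = 1}, and (ii) 𝒯 is injective on
𝔉₀ := {g ∈ 𝔉, g is of positive type}. Both (i) and (ii) are deduced from properties of [𝒯]^{1/r}, invoking for
(ii) the character expansion of g.»* (`𝒯 = 𝒯_r`, `(𝒯g)(u) = {g^{*r}(u)/g^{*r}(e₀)}^r`, (1.1) p.262.) Property (i)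
is the tree's `Migdal.tendstoUniformly_migdal`; property (ii) was, until this file, the hypothesis `hii` of
`MS87Theorem3Climb.{subseq_limits_eq_of_injective, climb_step, theorem3_climb}`.

**What this file proves (kernel-checked, 0 sorry, standard axioms; no definition, no named fact).** `G` any compact
Hausdorff group with its Haar probability measure; `𝔉` = the tree's `Migdal.InG`; «of positive type» = the tree's
`IsPosDefKernel (u, v) ↦ g(u⁻¹v)` (finite Gram sums, as in `MS87Theorem3Climb`); `T_g = convL2 g` the tree's
convolution operator on `L²(G)` (`QuantumLattice.HeatKernelGroupOperatorProofs`: compact, symmetric).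
* §1 a Gibbs factor of positive type is inversion-symmetric ((2.3)), and `(x, y) ↦ g(x y⁻¹)` is again a positive
  definite kernel (`isSymm_of_positiveType`, `isPosDefKernel_mul_inv`).
* §2 **positive type ⟹ `T_g ≥ 0` on `L²(G)`** (`inner_convL2_self_nonneg`): on continuous `u`,
  `⟪T_g u, u⟫ = ∫∫ u(x) u(y) g(x y⁻¹) dx dy ≥ 0` by the sibling `IsPosDefKernel.integral_integral_nonneg`
  (Gram sums of independent Haar samples), then density of `C(G)` in `L²(G)`.
* §3 the algebra of the `T_g`: `T_{k₁} T_{k₂} = T_{k₁ ⋆ k₂}` (`convL2_comp`), `T_{c k} = c T_k`, central kernels give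
  commuting operators, and `T_g ^ (m+1) = T_{g^{*(m+1)}}` (`convL2_pow_succ`, the tree's `Migdal.convPow`).
* §4 **the printed «[𝒯]^{1/r}» step** (`convPow_eq_smul_of_migdal_eq`): on `𝔉` the convolution powers are `≥ 0` and
  `> 0` at `e₀`, so `𝒯_r g₁ = 𝒯_r g₂` forces `g₁^{*r} = c · g₂^{*r}` with `c = g₁^{*r}(e₀)/g₂^{*r}(e₀) > 0` (`r ≥ 1`;
  injectivity of `t ↦ t^r` on `[0, ∞)`).
* §5 `T_{g₁} = d · T_{g₂}` with `g₁, g₂` continuous forces `g₁ = d · g₂` (`eq_smul_of_convL2_eq_smul`: apply to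
  `u(h) = (g₁ − d g₂)(h⁻¹)` and evaluate `(gᵢ ⋆ u)(e₀)`, giving `∫ (g₁ − d g₂)² = 0`).
* §6 **PROPERTY (ii)** (`migdal_injective_of_positiveType`): for `r ≥ 1` and `g₁, g₂ ∈ 𝔉₀` with `𝒯_r g₁ = 𝒯_r g₂`:
  §4 and §3 give `T_{g₁}^r = c · T_{g₂}^r = (c^{1/r} T_{g₂})^r`; both `T_{g₁}` and `c^{1/r} T_{g₂}` are compact,
  self-adjoint, positive (§2) and commute (§3), so they are EQUAL by the sibling `eq_of_pow_eq_of_nonneg`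
  (uniqueness of positive `r`-th roots — the character expansion in operator form, see the reading note); §5 then
  gives `g₁ = c^{1/r} g₂`, and `g₁(e₀) = g₂(e₀) = 1` gives `g₁ = g₂`. Also as `Set.InjOn` (`migdal_injOn_positiveType`)
  and plugged into the sibling's abstract inductive step `Migdal.thm3_inductive_step` (`thm3_inductive_step_positiveType`).
* §7 `G = SU(2)`: the hypothesis `hii` of `MS87Theorem3Climb` DISCHARGED for every `r ≥ 1` (`hii_holds`), and the
  unconditional forms of `climb_step` and of **THEOREM 3 BY THE PRINTED CLIMB** (`theorem3_climb_unconditional`: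
  along ANY strictly increasing cutoff sequence on which the scale-`0` functions converge, `h_{N_j}^{(−n)}` converges
  locally uniformly on `{|Im z| < d_n}` for EVERY `n` — same `N_j`, no further extraction), for `r ≥ 1`.
* (v1.1) §8 **«this property iterates too» (p.263) FOR EVERY `r ≥ 1` from a positive-type start** — the sibling
  `MS87PositiveTypeIterates` has it for even `r` (and then with no hypothesis on `g⁽⁰⁾`); here, for `g⁽⁰⁾ ∈ 𝔉` OF POSITIVE
  TYPE, ALL convolution powers `g^{*m}` are of positive type (`positiveType_convPow_all`: odd numbers of factors by the
  sandwich `g^{*a+1} ⋆ g ⋆ g^{*a+1}`, whose Gram sums are the double integrals `∫∫ φ(w)φ(z)g(w⁻¹z) ≥ 0` of the sibling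
  `IsPosDefKernel.integral_integral_nonneg`), hence `𝒯_r g⁽⁰⁾` and every iterate `𝒯_rⁿ g⁽⁰⁾` (`positiveType_migdal_all`,
  `positiveType_iterate_migdal_all`), and along cutoff families (`positiveType_of_initial_all`).
* (v1.1) §9 **`theorem3_climb_model`**: THEOREM 3 by the printed climb with (ii) DISCHARGED and the structural
  hypotheses (`𝔉`, positive type) assumed for the INITIAL Gibbs factors `g_N^{(−N)}` only (sibling
  `MS87Theorem3InitialData` + §8), every `r ≥ 1` — no hypothesis left beyond Theorem 2's analytic input (holomorphy,
  the bounds (6.18), evenness/periodicity, the angle representation) and the recursion.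
* (v1.2) §10 **`theorem3_climb_wilson`**: the same for the Wilson initial action — Theorem 3 p.282 holds «Under the
  assumptions of Theorem 2», whose hypothesis (p.280) gives the initial Gibbs factors «either by the Wilson action (2.5) …
  or by the heat kernel action (2.20)» (cf. p.263 L.12–13 «both for initial Wilson and heat kernel action»): with
  `g_N^{(−N)} = exp{2β_N(u₀ − 1)}` ((2.5)), `β_N ≥ 0`, the structural hypotheses are DISCHARGED too (sibling
  `MS87WilsonPositiveType`: the Wilson factor is in `𝔉` and of positive type) — only the analytic input remains.
* (v1.2) §11 **`theorem3_climb_heatKernel`**: the same for the heat-kernel initial action (Theorem 2 p.280 ∕ Theorem 3 p.282): with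
  `g_N^{(−N)} = g_HK(γ_N)` ((2.20)), `γ_N > 0`, the structural hypotheses are DISCHARGED as well (sibling
  `MS87HeatKernelPositiveType`: the heat-kernel factor is in `𝔉` and of positive type) — only the analytic input remains.
* (v1.3, docstrings only — referee-1 notes N-ref1-g102-2 ∕ N-ref1-g104-2; no declaration touched) (1) print's letter for
  the two classes of p.283 L.25–26 is Fraktur: `𝔉 := {g(u) continuous class function on G, g(u) ≧ 0, g(e₀) = 1}`,
  `𝔉₀ := {g ∈ 𝔉, g is of positive type}` — earlier versions of this file (and the sibling files, unchanged) wrote a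
  script 𝒢 for the same classes (`𝔉` = the tree's `Migdal.InG`); (2) the attribution of the Wilson ∕ heat-kernel
  alternative is Theorem 2's hypothesis p.280, quoted under §10 ∕ §11 (Theorem 3 p.282 reads «Under the assumptions of
  Theorem 2 …»); (3) §10 ∕ §11 now say explicitly that print's bare couplings are SPECIFIC — Wilson `β ≡ β_N^{(−N)} =
  B_N + c, c = 5∕18 {1∕3} for r = 2 {4}`, heat kernel `γ = B_N + 1∕6` (p.280) — and that the generality `β_N ≥ 0` ∕
  `γ_N > 0` of the two theorems rides on the ASSUMED analytic input (6.18), which the paper derives (Theorem 2) only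
  for that cutoff dependence.

**Reading note (declared).** The print deduces (ii) «invoking the character expansion of g»: for a class function of
positive type `g = Σ_π a_π χ_π` with `a_π ≥ 0`, and `g^{*r}` has coefficients `a_π^r / d_π^{r−1}`, so `g^{*r}`
determines the `a_π`, hence `g`. The proof below is the same argument in operator language, which the tree already
supports for an arbitrary compact group: the character coefficients `a_π/d_π` are the eigenvalues of the convolution
operator `T_g` on the isotypic subspaces, «`a_π ≥ 0`» is «`T_g ≥ 0`» (§2), and «`a_π^r` determines `a_π ≥ 0`» is the
uniqueness of positive `r`-th roots of commuting compact positive operators on their joint eigenspaces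
(`Analysis/OperatorTheory/CompactPositiveRootUnique`). No Peter–Weyl completeness is needed: `T_{g₁} = T_{g₂}` already
forces `g₁ = g₂` for continuous kernels (§5). The result is stated for `r ≥ 1` (`𝒯_0 ≡ 1` is not injective); the paper
uses `r = 2` (and `r = 4`).

**Not claimed.** Theorems 1, 2, 4; anything about lattice Yang–Mills or the Clay problem.
-/

noncomputable section

open MeasureTheory Filter Topology
open scoped InnerProductSpace

namespace Literature.MathematicalPhysics.QuantumFieldTheory

namespace MullerSchiemann1987

namespace MigdalInjective

open Literature.Analysis.Matrix (IsPosDefKernel)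
open Literature.MathematicalPhysics.QuantumLattice (haarConv haarConv_apply haarConv_eq_integral_mul_inv
  continuous_haarConv haarConv_haarConv haarConv_comm_of_central convL2 convL2_toLp convL2_isSymmetric
  isCompactOperator_convL2 denseRange_toLp inner_toLp_toLp convToCM convToCM_apply convL2_apply)
open Migdal (InG migdal convPow IsCentral IsSymm continuous_convPow convPow_nonneg convPow_apply_one_pos
  migdal_apply convPow_succ convPow_zero isCentral_convPow)

section General

variable {G : Type*} [Group G] [TopologicalSpace G] [IsTopologicalGroup G] [CompactSpace G] [T2Space G]
  [MeasurableSpace G] [BorelSpace G]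

/-! ## §1 Gibbs factors of positive type: inversion symmetry and the kernel `g(x y⁻¹)` -/

omit [TopologicalSpace G] [IsTopologicalGroup G] [CompactSpace G] [T2Space G] [MeasurableSpace G] [BorelSpace G] in
/-- A function of positive type is inversion-symmetric, `g(u⁻¹) = g(u)` ((2.3); positive definite kernels are
symmetric). [cite: MullerSchiemann1987, (2.3) p.263 and p.263 L.36–37] -/
theorem isSymm_of_positiveType {g : G → ℝ} (h : IsPosDefKernel fun u v : G => g (u⁻¹ * v)) : IsSymm g := by
  intro u
  have := h.1 u 1
  simpa using this

omit [TopologicalSpace G] [IsTopologicalGroup G] [CompactSpace G] [T2Space G] [MeasurableSpace G] [BorelSpace G] in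
/-- If `(u, v) ↦ g(u⁻¹v)` is a positive definite kernel then so is `(x, y) ↦ g(x y⁻¹)` (pull back along inversion:
`g(x y⁻¹) = g((x⁻¹)⁻¹ (y⁻¹))`). [cite: MullerSchiemann1987, p.263 L.36–37 («of positive type»)] -/
theorem isPosDefKernel_mul_inv {g : G → ℝ} (h : IsPosDefKernel fun u v : G => g (u⁻¹ * v)) :
    IsPosDefKernel fun x y : G => g (x * y⁻¹) := by
  refine ⟨fun x y => ?_, fun n x c => ?_⟩
  · have := h.1 x⁻¹ y⁻¹
    simpa using this
  · have := h.2 n (fun j => (x j)⁻¹) c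
    simpa using this

/-! ## §2 Positive type ⟹ the convolution operator `T_g` is positive on `L²(G)` -/

omit [T2Space G] in
/-- `⟪T_k u, v⟫ = ∫ (k ⋆ u) v` for continuous `u`, `v`. [folklore] -/
private theorem inner_convL2_toLp_toLp {k : G → ℝ} (hk : Continuous k) (u v : C(G, ℝ)) :
    ⟪convL2 hk (ContinuousMap.toLp 2 (haarProbability G) ℝ u), ContinuousMap.toLp 2 (haarProbability G) ℝ v⟫_ℝ =
      ∫ x, haarConv k u x * v x ∂(haarProbability G) := by
  rw [convL2_toLp, inner_toLp_toLp]
  rfl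

omit [T2Space G] in
/-- For continuous `u`: `∫ (g ⋆ u) u = ∫∫ u(x) u(y) g(x y⁻¹) dy dx`. [folklore] -/
private theorem integral_haarConv_mul_self {g : G → ℝ} (u : C(G, ℝ)) :
    ∫ x, haarConv g u x * u x ∂(haarProbability G) =
      ∫ x, ∫ y, u x * u y * g (x * y⁻¹) ∂(haarProbability G) ∂(haarProbability G) := by
  refine integral_congr_ae (Eventually.of_forall fun x => ?_)
  simp only [haarConv_eq_integral_mul_inv]
  rw [mul_comm, ← integral_const_mul]
  refine integral_congr_ae (Eventually.of_forall fun y => ?_)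
  simp only
  ring

/-- **Positive type ⟹ `⟪T_g f, f⟫ ≥ 0` on `L²(G)`.** For a continuous `g` with `(u, v) ↦ g(u⁻¹v)` positive definite
(finite Gram sums), the compact symmetric convolution operator `T_g = convL2 g` is positive: on continuous `u` the
pairing is the double integral `∫∫ u(x)u(y)g(xy⁻¹) ≥ 0` (`IsPosDefKernel.integral_integral_nonneg`, Gram sums of
independent Haar samples), and `C(G)` is dense in `L²(G)`. This is «g of positive type» in its integrated
(Bochner–Godement) form. [cite: MullerSchiemann1987, p.283 L.26–27 and p.263 L.36–37] -/
theorem inner_convL2_self_nonneg {g : G → ℝ} (hg : Continuous g) (hpd : IsPosDefKernel fun u v : G => g (u⁻¹ * v))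
    (f : Lp ℝ 2 (haarProbability G)) : 0 ≤ ⟪convL2 hg f, f⟫_ℝ := by
  -- continuous functions first
  have hcont : ∀ u : C(G, ℝ), 0 ≤ ⟪convL2 hg (ContinuousMap.toLp 2 (haarProbability G) ℝ u),
      ContinuousMap.toLp 2 (haarProbability G) ℝ u⟫_ℝ := by
    intro u
    rw [inner_convL2_toLp_toLp, integral_haarConv_mul_self]
    have hK : Continuous fun p : G × G => g (p.1 * p.2⁻¹) := hg.comp (continuous_fst.mul continuous_snd.inv)
    exact (isPosDefKernel_mul_inv hpd).integral_integral_nonneg hK (haarProbability G) u.continuous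
  -- density
  have hclosed : IsClosed {f : Lp ℝ 2 (haarProbability G) | 0 ≤ ⟪convL2 hg f, f⟫_ℝ} :=
    isClosed_le continuous_const ((convL2 hg).continuous.inner continuous_id)
  have hmem : f ∈ closure (Set.range (ContinuousMap.toLp 2 (haarProbability G) ℝ : C(G, ℝ) → _)) := by
    rw [denseRange_toLp.closure_range]; trivial
  exact closure_minimal (by rintro _ ⟨u, rfl⟩; exact hcont u) hclosed hmem

/-! ## §3 The algebra of the convolution operators -/

omit [T2Space G] in
/-- A continuous function on the compact group is Haar-integrable. [folklore] -/
private theorem integrable_of_continuous {f : G → ℝ} (hf : Continuous f) : Integrable f (haarProbability G) :=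
  hf.integrable_of_hasCompactSupport (HasCompactSupport.of_compactSpace _)

/-- **Composition = convolution of kernels**: `T_{k₁} ∘ T_{k₂} = T_{k₁ ⋆ k₂}` on `L²(G)` (both sides bounded, equal
on the dense continuous functions by associativity `haarConv_haarConv`). [folklore] -/
private theorem convL2_comp {k₁ k₂ : G → ℝ} (hk₁ : Continuous k₁) (hk₂ : Continuous k₂) :
    (convL2 hk₁).comp (convL2 hk₂) =
      convL2 (continuous_haarConv hk₁ (integrable_of_continuous hk₂) : Continuous (haarConv k₁ k₂)) := by
  have key : ⇑((convL2 hk₁).comp (convL2 hk₂)) =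
      ⇑(convL2 (G := G) (continuous_haarConv hk₁ (integrable_of_continuous hk₂))) := by
    refine denseRange_toLp.equalizer ((convL2 hk₁).comp (convL2 hk₂)).continuous (convL2 _).continuous ?_
    funext u
    simp only [Function.comp_apply, ContinuousLinearMap.coe_comp, convL2_toLp]
    congr 1
    ext x
    simp only [ContinuousMap.coe_mk]
    rw [haarConv_haarConv hk₁ hk₂ u.continuous]
  exact ContinuousLinearMap.coeFn_injective key

omit [T2Space G] in
/-- `T` only depends on the kernel (not on the continuity witness); equal kernels give equal operators. [folklore] -/
private theorem convL2_congr {k₁ k₂ : G → ℝ} (hk₁ : Continuous k₁) (hk₂ : Continuous k₂) (h : k₁ = k₂) :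
    convL2 (G := G) hk₁ = convL2 hk₂ := by
  subst h; rfl

omit [T2Space G] in
/-- **Homogeneity in the kernel**: `T_{c k} = c T_k`. [folklore] -/
private theorem convL2_const_mul {k : G → ℝ} (hk : Continuous k) (c : ℝ) :
    convL2 (G := G) (continuous_const.mul hk : Continuous fun x => c * k x) = c • convL2 hk := by
  ext1 f
  change _ = c • convL2 hk f
  rw [convL2_apply, convL2_apply, ← map_smul]
  congr 1
  ext x
  simp only [convToCM_apply, ContinuousMap.smul_apply, smul_eq_mul, haarConv_apply]
  rw [← integral_const_mul]
  refine integral_congr_ae (Eventually.of_forall fun h => ?_)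
  simp only [Pi.mul_apply]
  ring

/-- **Central kernels give commuting operators**: if `k₁` is a class function then `T_{k₁} T_{k₂} = T_{k₂} T_{k₁}`
(`k₁ ⋆ k₂ = k₂ ⋆ k₁`, `haarConv_comm_of_central`). [folklore] -/
private theorem commute_convL2 {k₁ k₂ : G → ℝ} (hk₁ : Continuous k₁) (hc₁ : IsCentral k₁) (hk₂ : Continuous k₂) :
    Commute (convL2 (G := G) hk₁) (convL2 hk₂) := by
  change (convL2 hk₁).comp (convL2 hk₂) = (convL2 hk₂).comp (convL2 hk₁)
  rw [convL2_comp hk₁ hk₂, convL2_comp hk₂ hk₁]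
  exact convL2_congr _ _ (haarConv_comm_of_central hc₁ k₂)

/-- **Powers = convolution powers**: `T_g ^ (m+1) = T_{g^{*(m+1)}}` with the tree's `convPow g m = g^{*(m+1)}`
((1.1) p.262). [cite: MullerSchiemann1987, (1.1) p.262] -/
theorem convL2_pow_succ {g : G → ℝ} (hg : Continuous g) (m : ℕ) :
    convL2 (G := G) hg ^ (m + 1) = convL2 (continuous_convPow hg m) := by
  induction m with
  | zero => rw [zero_add, pow_one]; rfl
  | succ m ih =>
      rw [pow_succ', ih]
      change (convL2 hg).comp (convL2 (continuous_convPow hg m)) = _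
      rw [convL2_comp]
      rfl

/-! ## §4 The printed «[𝒯]^{1/r}» step: `𝒯_r g₁ = 𝒯_r g₂` on `𝔉` forces `g₁^{*r} = c · g₂^{*r}` -/

omit [T2Space G] in
/-- **«deduced from properties of [𝒯]^{1/r}»** (p.283 L.26): on `𝔉` the convolution powers are pointwise `≥ 0` and
`> 0` at `e₀`, so `(𝒯_r g)^{1/r} = g^{*r}/g^{*r}(e₀)` is determined by `𝒯_r g`; hence `𝒯_r g₁ = 𝒯_r g₂` (`r ≥ 1`) gives
`g₁^{*r} = c · g₂^{*r}` with `c = g₁^{*r}(e₀)/g₂^{*r}(e₀)` (tree indexing: `convPow g (r−1) = g^{*r}`).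
[cite: MullerSchiemann1987, p.283 L.23–27, (1.1) p.262] -/
theorem convPow_eq_smul_of_migdal_eq {g₁ g₂ : G → ℝ} (hG₁ : InG g₁) (hG₂ : InG g₂) {r : ℕ} (hr : r ≠ 0)
    (h : migdal r g₁ = migdal r g₂) :
    convPow g₁ (r - 1) = fun u => (convPow g₁ (r - 1) 1 / convPow g₂ (r - 1) 1) * convPow g₂ (r - 1) u := by
  funext u
  have hu := congrFun h u
  simp only [migdal_apply] at hu
  have hA₁ := convPow_apply_one_pos hG₁ (r - 1)
  have hA₂ := convPow_apply_one_pos hG₂ (r - 1)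
  have ha₁ := convPow_nonneg hG₁.nonneg (r - 1) u
  have ha₂ := convPow_nonneg hG₂.nonneg (r - 1) u
  have hq : convPow g₁ (r - 1) u / convPow g₁ (r - 1) 1 = convPow g₂ (r - 1) u / convPow g₂ (r - 1) 1 :=
    (pow_left_inj₀ (div_nonneg ha₁ hA₁.le) (div_nonneg ha₂ hA₂.le) hr).mp hu
  rw [div_eq_iff hA₁.ne'] at hq
  rw [hq]
  ring

/-! ## §5 `T_{g₁} = d · T_{g₂}` forces `g₁ = d · g₂` for continuous kernels -/

omit [T2Space G] in
/-- If the convolution operators of two continuous kernels satisfy `T_{g₁} = d · T_{g₂}` on `L²(G)`, then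
`g₁ = d · g₂`: on continuous `u` one gets `g₁ ⋆ u = d · g₂ ⋆ u` as continuous functions (`toLp` is injective, Haar
measure charges open sets); with `u(h) = (g₁ − d g₂)(h⁻¹)` the values at `e₀` give `∫ (g₁ − d g₂)² = 0`. [folklore] -/
private theorem eq_smul_of_convL2_eq_smul {g₁ g₂ : G → ℝ} (hg₁ : Continuous g₁) (hg₂ : Continuous g₂) {d : ℝ}
    (h : convL2 (G := G) hg₁ = d • convL2 hg₂) : g₁ = fun u => d * g₂ u := by
  -- `g₁ ⋆ u = d · g₂ ⋆ u` for continuous `u`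
  have hconv : ∀ u : C(G, ℝ), ∀ x, haarConv g₁ u x = d * haarConv g₂ u x := by
    intro u x
    have h1 := congrArg (fun T => T (ContinuousMap.toLp 2 (haarProbability G) ℝ u)) h
    simp only [FunLike.coe_smul, Pi.smul_apply, convL2_toLp] at h1
    rw [← map_smul] at h1
    have h2 := ContinuousMap.toLp_injective (haarProbability G) h1
    have h3 := congrArg (fun w : C(G, ℝ) => w x) h2
    simpa using h3
  -- the difference `δ = g₁ − d g₂` has `∫ δ² = 0`
  set δ : G → ℝ := fun v => g₁ v - d * g₂ v with hδ
  have hδc : Continuous δ := hg₁.sub (continuous_const.mul hg₂)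
  let u : C(G, ℝ) := ⟨fun v => δ v⁻¹, hδc.comp continuous_inv⟩
  have h4 := hconv u 1
  simp only [haarConv_apply, mul_one, ContinuousMap.coe_mk, inv_inv, u] at h4
  have hi₁ : Integrable (fun v => g₁ v * δ v) (haarProbability G) := integrable_of_continuous (hg₁.mul hδc)
  have hi₂ : Integrable (fun v => g₂ v * δ v) (haarProbability G) := integrable_of_continuous (hg₂.mul hδc)
  have h5 : ∫ v, δ v ^ 2 ∂(haarProbability G) = 0 := by
    have h6 : (fun v => δ v ^ 2) = fun v => g₁ v * δ v - d * (g₂ v * δ v) := by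
      funext v; simp only [hδ]; ring
    rw [h6, integral_sub hi₁ (hi₂.const_mul d), integral_const_mul, h4, sub_self]
  -- hence `δ = 0` (continuous, non-negative square, Haar measure positive on opens)
  funext v
  by_contra hv
  have hv' : δ v ≠ 0 := fun h0 => hv (by simp only [hδ] at h0; linarith)
  have hpos := (hδc.pow 2).integral_pos_of_hasCompactSupport_nonneg_nonzero (μ := haarProbability G)
    (HasCompactSupport.of_compactSpace _) (fun w => sq_nonneg (δ w)) (pow_ne_zero 2 hv')
  exact hpos.ne' h5

/-! ## §6 PROPERTY (ii): `𝒯_r` is injective on `𝔉₀` -/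

/-- A real scalar is self-adjoint (trivial star). [folklore] -/
private theorem isSelfAdjoint_real (d : ℝ) : IsSelfAdjoint d := by
  rw [isSelfAdjoint_iff]; rfl

/-- **PROPERTY (ii) of the Migdal transformation** (p.283 L.26–27): for `r ≥ 1`, `𝒯_r` is INJECTIVE on
`𝔉₀ := {g ∈ 𝔉, g is of positive type}` — for any compact Hausdorff group `G`. Proof («deduced from properties of
[𝒯]^{1/r}, invoking the character expansion of g», in operator form): `𝒯_r g₁ = 𝒯_r g₂` gives
`g₁^{*r} = c · g₂^{*r}` (§4), i.e. `T_{g₁}^r = c · T_{g₂}^r = (c^{1/r} T_{g₂})^r` for the compact self-adjoint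
commuting convolution operators on `L²(G)`, both positive by positive type (§2); uniqueness of positive `r`-th roots
(`eq_of_pow_eq_of_nonneg`) gives `T_{g₁} = c^{1/r} T_{g₂}`, hence `g₁ = c^{1/r} g₂` (§5), and `g₁(e₀) = g₂(e₀) = 1`
gives `g₁ = g₂`. [cite: MullerSchiemann1987, Thm 3 proof p.283 L.23–27] -/
theorem migdal_injective_of_positiveType {r : ℕ} (hr : r ≠ 0) {g₁ g₂ : G → ℝ} (hG₁ : InG g₁) (hG₂ : InG g₂)
    (hP₁ : IsPosDefKernel fun u v : G => g₁ (u⁻¹ * v)) (hP₂ : IsPosDefKernel fun u v : G => g₂ (u⁻¹ * v))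
    (h : migdal r g₁ = migdal r g₂) : g₁ = g₂ := by
  obtain ⟨m, rfl⟩ : ∃ m, r = m + 1 := ⟨r - 1, (Nat.succ_pred_eq_of_ne_zero hr).symm⟩
  -- §4: `g₁^{*r} = c · g₂^{*r}`
  have hpow := convPow_eq_smul_of_migdal_eq hG₁ hG₂ hr h
  simp only [Nat.add_sub_cancel] at hpow
  set c : ℝ := convPow g₁ m 1 / convPow g₂ m 1 with hc
  have hcpos : 0 < c := div_pos (convPow_apply_one_pos hG₁ m) (convPow_apply_one_pos hG₂ m)
  -- the positive `r`-th root of `c`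
  set d : ℝ := c ^ ((m + 1 : ℕ) : ℝ)⁻¹ with hd
  have hdpos : 0 < d := Real.rpow_pos_of_pos hcpos _
  have hdpow : d ^ (m + 1) = c := Real.rpow_inv_natCast_pow hcpos.le (Nat.succ_ne_zero m)
  -- the operators
  set T₁ := convL2 (G := G) hG₁.continuous with hT₁
  set T₂ := convL2 (G := G) hG₂.continuous with hT₂
  have h1 : T₁ ^ (m + 1) = c • T₂ ^ (m + 1) := by
    rw [hT₁, hT₂, convL2_pow_succ, convL2_pow_succ, ← convL2_const_mul]
    exact convL2_congr _ _ hpow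
  have h2 : T₁ ^ (m + 1) = (d • T₂) ^ (m + 1) := by rw [smul_pow, hdpow, h1]
  -- compact, self-adjoint, positive, commuting
  have hT₁c : IsCompactOperator T₁ := isCompactOperator_convL2 hG₁.continuous
  have hT₂c : IsCompactOperator (d • T₂) := (isCompactOperator_convL2 hG₂.continuous).smul d
  have hT₁a : IsSelfAdjoint T₁ := ContinuousLinearMap.isSelfAdjoint_iff_isSymmetric.mpr
    (convL2_isSymmetric hG₁.continuous (isSymm_of_positiveType hP₁))
  have hT₂a : IsSelfAdjoint (d • T₂) := (isSelfAdjoint_real d).smul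
    (ContinuousLinearMap.isSelfAdjoint_iff_isSymmetric.mpr
      (convL2_isSymmetric hG₂.continuous (isSymm_of_positiveType hP₂)))
  have hT₁p : ∀ f, 0 ≤ ⟪T₁ f, f⟫_ℝ := inner_convL2_self_nonneg hG₁.continuous hP₁
  have hT₂p : ∀ f, 0 ≤ ⟪(d • T₂) f, f⟫_ℝ := fun f => by
    change 0 ≤ ⟪d • T₂ f, f⟫_ℝ
    rw [real_inner_smul_left]
    exact mul_nonneg hdpos.le (inner_convL2_self_nonneg hG₂.continuous hP₂ f)
  have hcomm : Commute T₁ (d • T₂) :=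
    (commute_convL2 hG₁.continuous hG₁.central hG₂.continuous).smul_right d
  -- uniqueness of positive `r`-th roots
  have heq : T₁ = d • T₂ :=
    Literature.Analysis.OperatorTheory.eq_of_pow_eq_of_nonneg hT₁c hT₂c hT₁a hT₂a hT₁p hT₂p hcomm
      (Nat.succ_ne_zero m) h2
  -- §5 and the normalisation `g(e₀) = 1`
  have hfun := eq_smul_of_convL2_eq_smul hG₁.continuous hG₂.continuous heq
  have hd1 : d = 1 := by
    have := congrFun hfun 1
    rw [hG₁.apply_one, hG₂.apply_one, mul_one] at this
    exact this.symm
  rw [hfun, hd1]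
  funext u
  exact one_mul _

/-- Property (ii) as an injectivity statement: `𝒯_r` is injective on `𝔉₀` (`r ≥ 1`).
[cite: MullerSchiemann1987, Thm 3 proof p.283 L.26–27] -/
theorem migdal_injOn_positiveType {r : ℕ} (hr : r ≠ 0) :
    Set.InjOn (migdal (G := G) r) {g | InG g ∧ IsPosDefKernel fun u v : G => g (u⁻¹ * v)} :=
  fun _ h₁ _ h₂ h => migdal_injective_of_positiveType hr h₁.1 h₂.1 h₁.2 h₂.2 h

/-- **Theorem 3's inductive step with (ii) discharged** (the sibling `Migdal.thm3_inductive_step`, abstract form,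
p.283 L.31–37): if the subsequential limits of the Gibbs factors `gs j ∈ 𝔉` form a «normal family» with limits in a
set `S₀ ⊆ 𝔉₀` (elements of `𝔉` of positive type) and `𝒯_r(gs j) → gₙ` uniformly (`r ≥ 1`), then there is `g ∈ S₀` with
`𝒯_r g = gₙ` and the WHOLE sequence `gs → g` uniformly — «thus there is a unique limit … due to (ii)».
[cite: MullerSchiemann1987, Thm 3 proof p.283 L.31–37] -/
theorem thm3_inductive_step_positiveType {gs : ℕ → G → ℝ} {S₀ : Set (G → ℝ)} {r : ℕ} (hr : r ≠ 0) {gn : G → ℝ}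
    (hgs : ∀ j, InG (gs j)) (hS₀ : ∀ g ∈ S₀, InG g ∧ IsPosDefKernel fun u v : G => g (u⁻¹ * v))
    (hnormal : ∀ φ : ℕ → ℕ, StrictMono φ →
      ∃ ψ : ℕ → ℕ, StrictMono ψ ∧ ∃ g ∈ S₀, TendstoUniformly (fun k => gs (φ (ψ k))) g atTop)
    (hlim : TendstoUniformly (fun j => migdal r (gs j)) gn atTop) :
    ∃ g ∈ S₀, migdal r g = gn ∧ TendstoUniformly gs g atTop :=
  Migdal.thm3_inductive_step hgs (fun g hg => (hS₀ g hg).1) hnormal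
    ((migdal_injOn_positiveType hr).mono fun g hg => hS₀ g hg) hlim

end General

/-! ## §7 `G = SU(2)`: the hypothesis `hii` of `MS87Theorem3Climb` discharged; THEOREM 3's printed climb
unconditional -/

section SU2

open HeatKernel (u0)
open Theorem3Climb (climb_step theorem3_climb)

/-- **The hypothesis `hii` of `MS87Theorem3Climb` HOLDS** for every `r ≥ 1` (property (ii) on `G = SU(2)`).
[cite: MullerSchiemann1987, Thm 3 proof p.283 L.26–27] -/
theorem hii_holds {r : ℕ} (hr : r ≠ 0) :
    ∀ g₁ g₂ : Matrix.specialUnitaryGroup (Fin 2) ℂ → ℝ, InG g₁ → InG g₂ →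
      IsPosDefKernel (fun u v => g₁ (u⁻¹ * v)) → IsPosDefKernel (fun u v => g₂ (u⁻¹ * v)) →
      migdal r g₁ = migdal r g₂ → g₁ = g₂ :=
  fun _ _ hG₁ hG₂ hP₁ hP₂ h => migdal_injective_of_positiveType hr hG₁ hG₂ hP₁ hP₂ h

/-- **The inductive step of the printed proof, unconditional** (p.283 L.29–37; `climb_step` with (ii) discharged):
normality at scale `n+1`, convergence of the scale-`n` Gibbs factors and `r ≥ 1` imply that the WHOLE sequence
`h_j^{(−n−1)}` converges locally uniformly on the strip. [cite: MullerSchiemann1987, Thm 3 proof p.283 L.29–37] -/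
theorem climb_step_unconditional {r : ℕ} (hr : r ≠ 0) {d' : ℝ} (hd' : 0 < d')
    {hs : ℕ → ℂ → ℂ} {gs gsn : ℕ → Matrix.specialUnitaryGroup (Fin 2) ℂ → ℝ}
    {gn : Matrix.specialUnitaryGroup (Fin 2) ℂ → ℝ}
    (hnormal : ∀ ψ : ℕ → ℕ, StrictMono ψ → ∃ φ : ℕ → ℕ, StrictMono φ ∧ ∃ f : ℂ → ℂ,
      DifferentiableOn ℂ f {z : ℂ | |z.im| < d'} ∧
      TendstoLocallyUniformlyOn (fun j => hs (ψ (φ j))) f atTop {z : ℂ | |z.im| < d'})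
    (heven : ∀ᶠ j in atTop, ∀ z, hs j (-z) = hs j z) (hper : ∀ᶠ j in atTop, Function.Periodic (hs j) (2 * Real.pi))
    (hgh : ∀ᶠ j in atTop, ∀ U, (gs j U : ℂ) = hs j (Real.arccos (u0 U)))
    (hG : ∀ᶠ j in atTop, InG (gs j)) (hpos : ∀ᶠ j in atTop, IsPosDefKernel fun u v => gs j (u⁻¹ * v))
    (hrec : ∀ᶠ j in atTop, migdal r (gs j) = gsn j) (hn : TendstoUniformly gsn gn atTop) :
    ∃ f : ℂ → ℂ, DifferentiableOn ℂ f {z : ℂ | |z.im| < d'} ∧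
      TendstoLocallyUniformlyOn hs f atTop {z : ℂ | |z.im| < d'} :=
  climb_step r hd' (hii_holds hr) hnormal heven hper hgh hG hpos hrec hn

/-- **THEOREM 3 BY THE PRINTED CLIMB, UNCONDITIONAL** (`theorem3_climb` with property (ii) discharged). For the
cutoff families on `SU(2)` (`h_N^{(−n)}` holomorphic and bounded by `M_n` on `{|Im z| < d_n}` (6.18), even,
`2π`-periodic; `g_N^{(−n)} = h_N^{(−n)} ∘ (arccos ∘ u₀) ∈ 𝔉` of positive type; `𝒯_r g_N^{(−n−1)} = g_N^{(−n)}` with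
`r ≥ 1`) and ANY strictly increasing sequence of cutoffs `N_j` along which the scale-`0` functions converge locally
uniformly on their strip, `h_{N_j}^{(−n)}` converges locally uniformly on `{|Im z| < d_n}` to a holomorphic limit for
EVERY scale `n` — the SAME subsequence, no further extraction: *«We fix the subsequence N_j such that (6.19) holds for
n = 0, and prove (6.19) inductively for all n ∈ ℕ … thus there is a unique limit g^{(−n−1)}(u) = lim_j g_{N_j}^{(−n−1)}(u)
due to (ii)»*. [cite: MullerSchiemann1987, Thm 3 p.282, proof p.282 L.29 – p.283 L.37] -/
theorem theorem3_climb_unconditional {r : ℕ} (hr : r ≠ 0) {d M : ℕ → ℝ} (hd : ∀ n, 0 < d n)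
    {h : ℕ → ℕ → ℂ → ℂ} {g : ℕ → ℕ → Matrix.specialUnitaryGroup (Fin 2) ℂ → ℝ}
    (hhol : ∀ N n, n ≤ N → DifferentiableOn ℂ (h N n) {z : ℂ | |z.im| < d n})
    (hbd : ∀ N n, n ≤ N → ∀ z : ℂ, |z.im| < d n → ‖h N n z‖ ≤ M n)
    (hper : ∀ N n, n ≤ N → Function.Periodic (h N n) (2 * Real.pi))
    (heven : ∀ N n, n ≤ N → ∀ z, h N n (-z) = h N n z)
    (hgh : ∀ N n, n ≤ N → ∀ U, (g N n U : ℂ) = h N n (Real.arccos (u0 U)))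
    (hG : ∀ N n, n ≤ N → InG (g N n))
    (hpos : ∀ N n, n ≤ N → IsPosDefKernel fun u v => g N n (u⁻¹ * v))
    (hrec : ∀ N n, n + 1 ≤ N → migdal r (g N (n + 1)) = g N n)
    {Nj : ℕ → ℕ} (hNj : StrictMono Nj) {f₀ : ℂ → ℂ}
    (h0 : TendstoLocallyUniformlyOn (fun j => h (Nj j) 0) f₀ atTop {z : ℂ | |z.im| < d 0}) :
    ∀ n, ∃ f : ℂ → ℂ, DifferentiableOn ℂ f {z : ℂ | |z.im| < d n} ∧
      TendstoLocallyUniformlyOn (fun j => h (Nj j) n) f atTop {z : ℂ | |z.im| < d n} :=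
  theorem3_climb r hd hhol hbd hper heven hgh hG hpos hrec (hii_holds hr) hNj h0

end SU2

/-! ## §8 (v1.1) «this property iterates too» for EVERY `r ≥ 1`, from a positive-type initial factor -/

section AllR

variable {G : Type*} [Group G] [TopologicalSpace G] [IsTopologicalGroup G] [CompactSpace G] [T2Space G]
  [MeasurableSpace G] [BorelSpace G]

open PositiveTypeIterates (convPow_add positiveType_convPow_odd inG_iterate_migdal)
open Migdal (isSymm_convPow isCentral_convPow isSymm_haarConv isCentral_haarConv inG_migdal isCentral_migdal)

omit [T2Space G] in
/-- For symmetric `f` ((2.3)) and any `F`: `(f ⋆ F)(u⁻¹v) = ∫ f(w⁻¹u) F(w⁻¹v) dw` (left invariance `w ↦ u⁻¹w`).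
[cite: MullerSchiemann1987, (1.1) p.262, (2.3) p.263] -/
theorem haarConv_apply_inv_mul_of_isSymm {f : G → ℝ} (hs : IsSymm f) (F : G → ℝ) (u v : G) :
    haarConv f F (u⁻¹ * v) = ∫ w, f (w⁻¹ * u) * F (w⁻¹ * v) ∂(haarProbability G) := by
  rw [haarConv_apply, ← integral_mul_left_eq_self (fun h => f h * F (h⁻¹ * (u⁻¹ * v))) u⁻¹]
  refine integral_congr_ae (Eventually.of_forall fun h => ?_)
  show f (u⁻¹ * h) * F ((u⁻¹ * h)⁻¹ * (u⁻¹ * v)) = f (h⁻¹ * u) * F (h⁻¹ * v)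
  rw [show (u⁻¹ * h)⁻¹ * (u⁻¹ * v) = h⁻¹ * v by group, ← hs (u⁻¹ * h), mul_inv_rev, inv_inv]

/-- **The sandwich `f ⋆ k ⋆ f` of a positive-type `k` between two copies of a symmetric class function `f` is of
positive type**: its Gram sums are `Σ cᵢcⱼ (f⋆k⋆f)(uᵢ⁻¹uⱼ) = ∫∫ φ(w) φ(z) k(w⁻¹z) dz dw ≥ 0` with
`φ(w) = Σ cᵢ f(w⁻¹uᵢ)` — the integrated positivity of the sibling `IsPosDefKernel.integral_integral_nonneg`.
[cite: MullerSchiemann1987, p.263 L.34–37 («this property iterates too»), (1.1) p.262] -/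
theorem positiveType_sandwich {f k : G → ℝ} (hf : Continuous f) (hfc : IsCentral f) (hfs : IsSymm f)
    (hk : Continuous k) (hkc : IsCentral k) (hpd : IsPosDefKernel fun u v : G => k (u⁻¹ * v)) :
    IsPosDefKernel fun u v : G => haarConv f (haarConv k f) (u⁻¹ * v) := by
  have hks : IsSymm k := isSymm_of_positiveType hpd
  have hkf : Continuous (haarConv k f) := continuous_haarConv hk (integrable_of_continuous hf)
  refine ⟨fun u v => ?_, fun n x c => ?_⟩
  · -- symmetry: `f ⋆ (k ⋆ f)` is symmetric
    have hsym : IsSymm (haarConv f (haarConv k f)) := isSymm_haarConv hfc hfs (isSymm_haarConv hkc hks hfs)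
    have := hsym (u⁻¹ * v)
    rw [mul_inv_rev, inv_inv] at this
    exact this.symm
  · -- the Gram sum as a double integral
    set φ : G → ℝ := fun w => ∑ i, c i * f (w⁻¹ * x i) with hφ
    have hφc : Continuous φ := by
      refine continuous_finsetSum _ fun i _ => continuous_const.mul (hf.comp (continuous_inv.mul continuous_const))
    -- inner convolution: `(k ⋆ f)(w⁻¹ uⱼ) = ∫ k(z⁻¹w) f(z⁻¹uⱼ) dz`, and `k(z⁻¹w) = k(w⁻¹z)`
    have hinner : ∀ w u : G, haarConv k f (w⁻¹ * u) = ∫ z, k (w⁻¹ * z) * f (z⁻¹ * u) ∂(haarProbability G) := by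
      intro w u
      rw [haarConv_apply_inv_mul_of_isSymm hks]
      refine integral_congr_ae (Eventually.of_forall fun z => ?_)
      show k (z⁻¹ * w) * f (z⁻¹ * u) = k (w⁻¹ * z) * f (z⁻¹ * u)
      rw [← hks (z⁻¹ * w), mul_inv_rev, inv_inv]
    -- `Σⱼ cⱼ (k ⋆ f)(w⁻¹uⱼ) = ∫ k(w⁻¹z) φ(z) dz`
    have hsumj : ∀ w : G, ∑ j, c j * haarConv k f (w⁻¹ * x j) =
        ∫ z, k (w⁻¹ * z) * φ z ∂(haarProbability G) := by
      intro w
      have hint : ∀ j, Integrable (fun z => c j * (k (w⁻¹ * z) * f (z⁻¹ * x j))) (haarProbability G) := fun j =>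
        (integrable_of_continuous ((hk.comp (continuous_const.mul continuous_id)).mul
          (hf.comp (continuous_inv.mul continuous_const)))).const_mul _
      simp_rw [hinner, ← integral_const_mul]
      rw [← integral_finsetSum _ fun j _ => hint j]
      refine integral_congr_ae (Eventually.of_forall fun z => ?_)
      simp only [hφ, Finset.mul_sum]
      exact Finset.sum_congr rfl fun j _ => by ring
    -- the Gram sum
    have hterm : ∀ i j, Integrable (fun w => c i * c j * (f (w⁻¹ * x i) * haarConv k f (w⁻¹ * x j)))
        (haarProbability G) := fun i j =>
      (integrable_of_continuous ((hf.comp (continuous_inv.mul continuous_const)).mul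
        (hkf.comp (continuous_inv.mul continuous_const)))).const_mul _
    have e1 : ∑ i, ∑ j, c i * c j * haarConv f (haarConv k f) ((x i)⁻¹ * x j) =
        ∫ w, ∑ i, ∑ j, c i * c j * (f (w⁻¹ * x i) * haarConv k f (w⁻¹ * x j)) ∂(haarProbability G) := by
      rw [integral_finsetSum _ fun i _ => integrable_finsetSum _ fun j _ => hterm i j]
      refine Finset.sum_congr rfl fun i _ => ?_
      rw [integral_finsetSum _ fun j _ => hterm i j]
      refine Finset.sum_congr rfl fun j _ => ?_
      rw [haarConv_apply_inv_mul_of_isSymm hfs, ← integral_const_mul]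
    have e2 : ∀ w : G, ∑ i, ∑ j, c i * c j * (f (w⁻¹ * x i) * haarConv k f (w⁻¹ * x j)) =
        φ w * ∫ z, k (w⁻¹ * z) * φ z ∂(haarProbability G) := by
      intro w
      rw [← hsumj w, hφ, Finset.sum_mul_sum]
      exact Finset.sum_congr rfl fun i _ => Finset.sum_congr rfl fun j _ => by ring
    have e3 : ∀ w : G, φ w * ∫ z, k (w⁻¹ * z) * φ z ∂(haarProbability G) =
        ∫ z, φ w * φ z * k (w⁻¹ * z) ∂(haarProbability G) := by
      intro w
      rw [← integral_const_mul]
      refine integral_congr_ae (Eventually.of_forall fun z => ?_)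
      ring
    rw [e1]
    simp_rw [e2, e3]
    have hK : Continuous fun p : G × G => k (p.1⁻¹ * p.2) := hk.comp (continuous_fst.inv.mul continuous_snd)
    exact hpd.integral_integral_nonneg hK (haarProbability G) hφc

/-- **ALL convolution powers of a positive-type `g ∈ 𝔉`-like factor are of positive type** (`g` continuous, central,
of positive type): even numbers of factors by the sibling `positiveType_convPow_odd` (`g^{*(2a+2)} = g^{*(a+1)} ⋆
g^{*(a+1)}`, no positive-type hypothesis needed), odd numbers `2a+3` by the sandwich `g^{*(a+1)} ⋆ g ⋆ g^{*(a+1)}`,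
and one factor by hypothesis. [cite: MullerSchiemann1987, p.263 L.34–37, (1.1) p.262] -/
theorem positiveType_convPow_all {g : G → ℝ} (hg : Continuous g) (hc : IsCentral g)
    (hpd : IsPosDefKernel fun u v : G => g (u⁻¹ * v)) : ∀ n, IsPosDefKernel fun u v : G => convPow g n (u⁻¹ * v) := by
  have hs : IsSymm g := isSymm_of_positiveType hpd
  intro n
  rcases Nat.even_or_odd n with ⟨a, rfl⟩ | ⟨a, rfl⟩
  · cases a with
    | zero => simpa using hpd
    | succ a =>
        -- `n = 2a + 2`: `g^{*(2a+3)} = g^{*(a+1)} ⋆ (g ⋆ g^{*(a+1)})`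
        have e : convPow g (a + 1 + (a + 1)) = haarConv (convPow g a) (haarConv g (convPow g a)) := by
          rw [show a + 1 + (a + 1) = a + (a + 1) + 1 by ring, convPow_add hg a (a + 1), convPow_succ]
        rw [e]
        exact positiveType_sandwich (continuous_convPow hg a) (isCentral_convPow hc a) (isSymm_convPow hc hs a) hg hc hpd
  · exact positiveType_convPow_odd hg hc hs a

/-- **`𝒯_r g` is of positive type for EVERY `r ≥ 1`** when `g ∈ 𝔉` is of positive type (kernel
`= (g^{*r}(e₀)^r)⁻¹ · [g^{*r}(u⁻¹v)]^r`, a nonnegative multiple of a Schur power).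
[cite: MullerSchiemann1987, p.263 L.34–37, (1.1) p.262] -/
theorem positiveType_migdal_all {g : G → ℝ} (hg : InG g) (hpd : IsPosDefKernel fun u v : G => g (u⁻¹ * v))
    (r : ℕ) : IsPosDefKernel fun u v : G => migdal r g (u⁻¹ * v) := by
  have e : (fun u v => migdal r g (u⁻¹ * v)) = fun u v =>
      (convPow g (r - 1) 1 ^ r)⁻¹ * convPow g (r - 1) (u⁻¹ * v) ^ r := by
    funext u v
    rw [migdal_apply, div_pow, div_eq_inv_mul]
  rw [e]
  exact ((positiveType_convPow_all hg.continuous hg.central hpd (r - 1)).pow r).const_mul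
    (inv_nonneg.mpr (pow_nonneg (convPow_apply_one_pos hg (r - 1)).le r))

/-- **«this property iterates too» for every `r`**: if `g⁽⁰⁾ ∈ 𝔉` is of positive type then so is every iterate
`g⁽ⁿ⁾ = 𝒯_rⁿ g⁽⁰⁾`. [cite: MullerSchiemann1987, p.263 L.34–37] -/
theorem positiveType_iterate_migdal_all (r : ℕ) {g : G → ℝ} (hg : InG g)
    (hpd : IsPosDefKernel fun u v : G => g (u⁻¹ * v)) :
    ∀ n, IsPosDefKernel fun u v : G => ((migdal r)^[n] g) (u⁻¹ * v)
  | 0 => by simpa using hpd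
  | n + 1 => by
      rw [Function.iterate_succ_apply']
      exact positiveType_migdal_all (inG_iterate_migdal r hg n) (positiveType_iterate_migdal_all r hg hpd n) r

/-- **Positive type at every scale from positive type at the initial scale, every `r`**: for a cutoff family linked
by `𝒯_r` (`𝒯_r (g N (n+1)) = g N n`) with initial factors `g N N ∈ 𝔉` of positive type, every `g N n`, `n ≤ N`, is of
positive type (the sibling `Theorem3InitialData.positiveType_of_initial` without the parity restriction).
[cite: MullerSchiemann1987, p.263 L.34–37, (6.17) p.281] -/
theorem positiveType_of_initial_all (r : ℕ) {g : ℕ → ℕ → G → ℝ}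
    (hrec : ∀ N n, n + 1 ≤ N → migdal r (g N (n + 1)) = g N n) (hinit : ∀ N, InG (g N N))
    (hpos : ∀ N, IsPosDefKernel fun u v : G => g N N (u⁻¹ * v)) :
    ∀ N n, n ≤ N → IsPosDefKernel fun u v : G => g N n (u⁻¹ * v) := by
  intro N n hn
  rw [Theorem3InitialData.eq_iterate_of_rec r hrec N n hn]
  exact positiveType_iterate_migdal_all r (hinit N) (hpos N) (N - n)

end AllR

/-! ## §9 (v1.1) THEOREM 3 for the model: initial data only, (ii) discharged, every `r ≥ 1` -/

section Model

open HeatKernel (u0)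
open Theorem3Climb (theorem3_climb)
open Theorem3InitialData (inG_of_initial)

/-- **THEOREM 3 BY THE PRINTED CLIMB — MODEL FORM** (every `r ≥ 1`; property (ii) DISCHARGED by `hii_holds`; the
structural hypotheses `𝔉` ∕ positive type assumed for the INITIAL Gibbs factors `g_N^{(−N)}` only and propagated to
all scales by §8 — «this property iterates too», p.263): for cutoff families on `SU(2)` with `h_N^{(−n)}` holomorphic
and bounded by `M_n` on `{|Im z| < d_n}` (6.18), even, `2π`-periodic, `g_N^{(−n)} = h_N^{(−n)} ∘ (arccos ∘ u₀)`,
`𝒯_r g_N^{(−n−1)} = g_N^{(−n)}`, `g_N^{(−N)} ∈ 𝔉` of positive type, and ANY strictly increasing cutoff sequence along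
which the scale-`0` functions converge locally uniformly, `h_{N_j}^{(−n)}` converges locally uniformly on
`{|Im z| < d_n}` to a holomorphic limit for EVERY scale `n` — same `N_j`, no further extraction.
[cite: MullerSchiemann1987, Thm 3 p.282, proof p.282 L.29 – p.283 L.37, p.263 L.29–37] -/
theorem theorem3_climb_model {r : ℕ} (hr : r ≠ 0) {d M : ℕ → ℝ} (hd : ∀ n, 0 < d n)
    {h : ℕ → ℕ → ℂ → ℂ} {g : ℕ → ℕ → Matrix.specialUnitaryGroup (Fin 2) ℂ → ℝ}
    (hhol : ∀ N n, n ≤ N → DifferentiableOn ℂ (h N n) {z : ℂ | |z.im| < d n})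
    (hbd : ∀ N n, n ≤ N → ∀ z : ℂ, |z.im| < d n → ‖h N n z‖ ≤ M n)
    (hper : ∀ N n, n ≤ N → Function.Periodic (h N n) (2 * Real.pi))
    (heven : ∀ N n, n ≤ N → ∀ z, h N n (-z) = h N n z)
    (hgh : ∀ N n, n ≤ N → ∀ U, (g N n U : ℂ) = h N n (Real.arccos (u0 U)))
    (hinit : ∀ N, InG (g N N)) (hpos : ∀ N, IsPosDefKernel fun u v => g N N (u⁻¹ * v))
    (hrec : ∀ N n, n + 1 ≤ N → migdal r (g N (n + 1)) = g N n)
    {Nj : ℕ → ℕ} (hNj : StrictMono Nj) {f₀ : ℂ → ℂ}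
    (h0 : TendstoLocallyUniformlyOn (fun j => h (Nj j) 0) f₀ atTop {z : ℂ | |z.im| < d 0}) :
    ∀ n, ∃ f : ℂ → ℂ, DifferentiableOn ℂ f {z : ℂ | |z.im| < d n} ∧
      TendstoLocallyUniformlyOn (fun j => h (Nj j) n) f atTop {z : ℂ | |z.im| < d n} :=
  theorem3_climb r hd hhol hbd hper heven hgh (inG_of_initial r hrec hinit)
    (positiveType_of_initial_all r hrec hinit hpos) hrec (hii_holds hr) hNj h0

end Model

/-! ## §10 (v1.2) THEOREM 3 for the Wilson initial action (Theorem 2's hypothesis, p.280): only the analytic hypotheses remain -/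

section Wilson

open HeatKernel (u0)
open WilsonAction (wilson_initial_data)

/-- **THEOREM 3 BY THE PRINTED CLIMB FOR THE WILSON INITIAL DATA** (every `r ≥ 1`): for cutoff families whose
initial Gibbs factor is the Wilson factor (2.5), `g_N^{(−N)}(u) = exp{2β_N(u₀(u) − 1)}` with bare couplings
`β_N ≥ 0` (print, Theorem 2 p.280: «Let the initial Gibbs factors g_N^{(−N)}(u) for the "cutoffs" N ∈ ℕ₀ be given
either by the Wilson action (2.5) with β ≡ β_N^{(−N)} = B_N + c, c = 5∕18 {1∕3} for r = 2{4} or by the heat kernel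
action (2.20) with γ = B_N + 1∕6»; Theorem 3 p.282: «Under the assumptions of Theorem 2 …» — print's bare coupling is
that SPECIFIC `B_N + c`; the generality `β_N ≥ 0` here is admissible only because the analytic input (6.18), which the
paper DERIVES for that cutoff dependence in Theorem 2, is a HYPOTHESIS of this theorem), the structural hypotheses of
`theorem3_climb_model` — `g_N^{(−N)} ∈ 𝔉` and of positive type (the sibling
`WilsonAction.wilson_initial_data`) — and property (ii) (`hii_holds`) are ALL DISCHARGED: what remains assumed is the
analytic input of the printed proof ((6.18): `h_N^{(−n)}` holomorphic and bounded by `M_n` on `{|Im z| < d_n}` — the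
paper's Theorems 1–2 —, evenness and `2π`-periodicity, `g_N^{(−n)} = h_N^{(−n)} ∘ (arccos ∘ u₀)`, the recursion
`𝒯_r g_N^{(−n−1)} = g_N^{(−n)}`, and locally uniform convergence at scale `0` along the cutoff sequence `N_j`); the
conclusion is locally uniform convergence of `h_{N_j}^{(−n)}` to a holomorphic limit at EVERY scale `n`, same `N_j`.
[cite: MullerSchiemann1987, Thm 3 p.282 («Under the assumptions of Theorem 2»), Thm 2 p.280 («either by the Wilson action (2.5) … or by the heat kernel action (2.20)»), proof p.282 L.29 – p.283 L.37, (2.5) p.264, p.263 L.12–13 and L.29–35] -/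
theorem theorem3_climb_wilson {r : ℕ} (hr : r ≠ 0) {d M : ℕ → ℝ} (hd : ∀ n, 0 < d n)
    {h : ℕ → ℕ → ℂ → ℂ} {g : ℕ → ℕ → Matrix.specialUnitaryGroup (Fin 2) ℂ → ℝ} {βN : ℕ → ℝ}
    (hβ : ∀ N, 0 ≤ βN N) (hW : ∀ N, g N N = fun U => Real.exp (2 * βN N * (u0 U - 1)))
    (hhol : ∀ N n, n ≤ N → DifferentiableOn ℂ (h N n) {z : ℂ | |z.im| < d n})
    (hbd : ∀ N n, n ≤ N → ∀ z : ℂ, |z.im| < d n → ‖h N n z‖ ≤ M n)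
    (hper : ∀ N n, n ≤ N → Function.Periodic (h N n) (2 * Real.pi))
    (heven : ∀ N n, n ≤ N → ∀ z, h N n (-z) = h N n z)
    (hgh : ∀ N n, n ≤ N → ∀ U, (g N n U : ℂ) = h N n (Real.arccos (u0 U)))
    (hrec : ∀ N n, n + 1 ≤ N → migdal r (g N (n + 1)) = g N n)
    {Nj : ℕ → ℕ} (hNj : StrictMono Nj) {f₀ : ℂ → ℂ}
    (h0 : TendstoLocallyUniformlyOn (fun j => h (Nj j) 0) f₀ atTop {z : ℂ | |z.im| < d 0}) :
    ∀ n, ∃ f : ℂ → ℂ, DifferentiableOn ℂ f {z : ℂ | |z.im| < d n} ∧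
      TendstoLocallyUniformlyOn (fun j => h (Nj j) n) f atTop {z : ℂ | |z.im| < d n} :=
  theorem3_climb_model hr hd hhol hbd hper heven hgh (wilson_initial_data hβ hW).1 (wilson_initial_data hβ hW).2.2
    hrec hNj h0

end Wilson

/-! ## §11 (v1.2) THEOREM 3 for the heat-kernel initial action (Theorem 2's hypothesis, p.280): only the analytic hypotheses remain -/

section HeatKernelData

open HeatKernel (u0 gHK)
open HeatKernelPositiveType (heatKernel_initial_data)

/-- **THEOREM 3 BY THE PRINTED CLIMB FOR THE HEAT-KERNEL INITIAL DATA** (every `r ≥ 1`): for cutoff families whose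
initial Gibbs factor is the heat-kernel factor (2.20), `g_N^{(−N)} = g_HK(γ_N)` with `γ_N > 0` (print, Theorem 2 p.280:
«… or by the heat kernel action (2.20) with γ = B_N + 1∕6»; Theorem 3 p.282: «Under the assumptions of Theorem 2 …» —
print's `γ` is that SPECIFIC `B_N + 1∕6`; the generality `γ_N > 0` here rides on the ASSUMED analytic input (6.18), derived
in the paper (Theorem 2) only for that cutoff dependence), the structural hypotheses of `theorem3_climb_model` — `g_N^{(−N)} ∈ 𝔉` and
of positive type (the sibling `HeatKernelPositiveType.heatKernel_initial_data`: every SU(2) character, hence `g_HK`, is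
of positive type, p.263 L.34–35) — and property (ii) (`hii_holds`) are ALL DISCHARGED: what remains assumed is the
analytic input of the printed proof ((6.18): `h_N^{(−n)}` holomorphic and bounded by `M_n` on `{|Im z| < d_n}` — the
paper's Theorems 1–2 —, evenness and `2π`-periodicity, `g_N^{(−n)} = h_N^{(−n)} ∘ (arccos ∘ u₀)`, the recursion
`𝒯_r g_N^{(−n−1)} = g_N^{(−n)}`, and locally uniform convergence at scale `0` along the cutoff sequence `N_j`); the
conclusion is locally uniform convergence of `h_{N_j}^{(−n)}` to a holomorphic limit at EVERY scale `n`, same `N_j`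
(the companion of §10 `theorem3_climb_wilson` for the other initial action named in Theorem 3).
[cite: MullerSchiemann1987, Thm 3 p.282 («Under the assumptions of Theorem 2»), Thm 2 p.280 («or by the heat kernel action (2.20)»), proof p.282 L.29 – p.283 L.37, (2.20) p.265, p.263 L.12–13 and L.29–35, p.283 L.23–28] -/
theorem theorem3_climb_heatKernel {r : ℕ} (hr : r ≠ 0) {d M : ℕ → ℝ} (hd : ∀ n, 0 < d n)
    {h : ℕ → ℕ → ℂ → ℂ} {g : ℕ → ℕ → Matrix.specialUnitaryGroup (Fin 2) ℂ → ℝ} {γN : ℕ → ℝ}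
    (hγ : ∀ N, 0 < γN N) (hHK : ∀ N, g N N = gHK (γN N))
    (hhol : ∀ N n, n ≤ N → DifferentiableOn ℂ (h N n) {z : ℂ | |z.im| < d n})
    (hbd : ∀ N n, n ≤ N → ∀ z : ℂ, |z.im| < d n → ‖h N n z‖ ≤ M n)
    (hper : ∀ N n, n ≤ N → Function.Periodic (h N n) (2 * Real.pi))
    (heven : ∀ N n, n ≤ N → ∀ z, h N n (-z) = h N n z)
    (hgh : ∀ N n, n ≤ N → ∀ U, (g N n U : ℂ) = h N n (Real.arccos (u0 U)))
    (hrec : ∀ N n, n + 1 ≤ N → migdal r (g N (n + 1)) = g N n)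
    {Nj : ℕ → ℕ} (hNj : StrictMono Nj) {f₀ : ℂ → ℂ}
    (h0 : TendstoLocallyUniformlyOn (fun j => h (Nj j) 0) f₀ atTop {z : ℂ | |z.im| < d 0}) :
    ∀ n, ∃ f : ℂ → ℂ, DifferentiableOn ℂ f {z : ℂ | |z.im| < d n} ∧
      TendstoLocallyUniformlyOn (fun j => h (Nj j) n) f atTop {z : ℂ | |z.im| < d n} :=
  theorem3_climb_model hr hd hhol hbd hper heven hgh (heatKernel_initial_data hγ hHK).1
    (heatKernel_initial_data hγ hHK).2.2 hrec hNj h0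

end HeatKernelData

end MigdalInjective

end MullerSchiemann1987

end Literature.MathematicalPhysics.QuantumFieldTheory
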